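/-
Copyright: the b2b-balaban T⁴-continuum CRUX team, row NE7b, leaf lineage `t4-ne7b-formalise-leaf-02` (gen 131). Project licence.
-/
import Mathlib.Data.ZMod.Basic
import Mathlib.Data.Real.Basic
import Mathlib.Tactic.Abel
import Mathlib.Tactic.Ring

/-!
# THE MULTIPLICITIES OF LEMMA CS ∕ (5.2) AS KERNEL COUNTS: on the fine periodic lattice `(ℤ∕N)^d`, a square surface of side `n` based at `x` in the
# plane `{μ, ν}` has at most `n²` plaquettes and at most `4n` boundary bonds; every fine plaquette lies in at most `n²` based squares and every fine
# bond lies on the boundary of at most `2(d−1)·n` based squares — print's «`L^{2k}`», «`4L^k`», «at most `L^{2k}` pairs `(P, x)`» and «`2L^k` per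
# plane, `2(d−1)L^k` in all» with `n = L^k`, the letters `#S·u ≤ 1`, `#T·v ≤ t`, `m₁`, `m₂` of `…CovariantStokesCounting` BY VALUE up to the
# block weight `η^d` (row NE7b, node U5c; the (h1) slot of print's `γ₀` assembly, `SectE-interface-proof.md` §5.2; the `n = 1` case is this
# lineage's `…TorusPlaquetteIncidence`)

Cell `pub-balaban`, sub-cell `t4`, spine estimate NE7b (`T4WeightBudget.RelWeightBound`; the cell's OWN estimate — NOT PRINTED in
[Bałaban 1983–89], NOT PROVED).  Crux-route work under `Spine/NE7b/` by the row's E-side ∕ key-readings ∕ lattice-geometry leaf lineage; NOTHING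
of Bałaban's is named or asserted; no `T4Continuum/Support` leaf typed; no `def`, no notation; zero `sorry`.  Imports: Mathlib ONLY.

WHY (located).  `…CovariantStokesCounting.sum_sq_le_of_blockAverage_bound` (leaf-05 g154, p-landed 14:27Z 2026-08-24) types the memo's passage
from Lemma CS to (5.2) over four abstract index types with DISPLAYED letters: `#S(P,x)·u ≤ 1`, `#T(P,x)·v ≤ t`, and the weighted multiplicities
`Σ_{(P,x) ∋ q} w ≤ m₁`, `Σ_{(P,x) ∋ b} w ≤ m₂`; its NOT HERE names «the lattice instance (which `P, X, q, b`, the sets `S_x(P)`, `∂S_x(P)`, the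
numbers `η, L, k, d`)».  The memo (§5.2, after Lemma CS): `S_x(P)` is the unit square `x + [0,1]e_μ × [0,1]e_ν` tiled by `L^{2k}` fine plaquettes,
`∂S_x(P)` its boundary of `4L^k` fine bonds; «a fine plaquette lies in `S_x(P)` for at most `L^{2k}` pairs `(P, x)` of its own orientation — `x`
determines the block, hence `P`»; «a fine bond of direction `μ` lies on `∂S_x(P)` for at most `2L^k` pairs `(P, x)` per plane `(μ, ν)`, `ν ≠ μ`, i.e.
`≤ 2(d−1)L^k` in all».  Since `x` determines `P`'s corner, the pairs `(P, x)` are the pairs (fine base point `x`, plane `a`); THIS FILE counts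
exactly those, on `(ℤ∕N)^d` with squares of ANY side `n` (print: `n = L^k`, `N = L^k·|Λ_k|^{1∕d}`), with no weight — and, in §4, in print's own
`(P, x ∈ B^k(y_P))` indexing on the two-scale torus `(ℤ∕nM)^d` (block points `n·y + r` are distinct, so the bounds transfer); the weight
`η^d = n^{−d}` and the identification with print's `M_k` blocks are the consumer's instance ((A3) ∕ (A1c)), multiplied on afterwards.

WHAT IS PROVED ([folklore] lattice combinatorics; sites `x : Fin d → ZMod N`, bonds `(x, μ)`, plaquettes `(x, ⟨(μ, ν), μ < ν⟩)`; the based square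
`Sq x a` (the `n²` fine plaquettes `(x + i e_μ + j e_ν, a)`, `i, j < n`) and its boundary `Bd x a` (the `4n` fine bonds `(x + i e_μ, μ)`,
`(x + n e_μ + j e_ν, ν)`, `(x + n e_ν + i e_μ, μ)`, `(x + j e_ν, ν)`) are carried by characterising hypotheses `hSq`, `hBd` — images of
`Fin n × Fin n` ∕ `Bool × Bool × Fin n` — inhabited by `exists_square`, `exists_boundary`; `e_μ = Pi.single μ 1`; at `n = 1` the boundary is
`…TorusPlaquetteIncidence`'s four-bond list, so that file's `2(d−1)` is this file's bond count at `n = 1`):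
* §1 sizes: **`card_square_le`** (`#Sq x a ≤ n²` — print's `Σ_{p∈S_x} η² ≤ 1` with `u = η² = n⁻²`), **`card_boundary_le`** (`#Bd x a ≤ 4n` — print's
  `Σ_{b∈∂S_x} η ≤ 4` with `v = η = n⁻¹`, `t = 4`).
* §2 multiplicities: **`square_multiplicity_le`** (every fine plaquette lies in at most `n²` based squares `(x, a)` — only its own plane occurs),
  **`boundary_multiplicity_le`** (every fine bond lies on the boundary of at most `2·(d−1)·n` based squares: cover by
  `{ν // ν ≠ μ} × Bool × Fin n` — plane partner, near ∕ far side, position along the side), `boundary_multiplicity_le_four`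
  (`d = 4`: `≤ 6n`).
* §3 the consumer's normalisation letters BY VALUE for `n ≥ 1`: `card_square_mul_inv_sq_le_one` (`#Sq·n⁻² ≤ 1`), `card_boundary_mul_inv_le_four`
  (`#Bd·n⁻¹ ≤ 4`) — the `hS` ∕ `hT` shapes of `…CovariantStokesCounting.sq_usum_le` ∕ `sq_vsum_le` with `u = η²`, `v = η`, `t = 4`.
* §4 the TWO-SCALE torus `(ℤ∕nM)^d` in print's `(P, x ∈ B^k(y_P))` indexing: **`blockPoint_injective`** (`(y, r) ↦ (n·val y_i + r_i)_i` is injective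
  on `(Fin d → ZMod M) × (Fin d → Fin n)`), hence **`block_square_multiplicity_le`** ∕ **`block_boundary_multiplicity_le`** — the same bounds `n²` ∕
  `2(d−1)n` for the counts over pairs ((coarse plaquette `(y, a)`), offset `r`), i.e. exactly the index shape `Σ_{(P,x) ∋ q}` ∕ `Σ_{(P,x) ∋ b}` of the
  consumer's `m₁` ∕ `m₂` before the weight `η^d` is multiplied on.

NOT HERE (honest): equalities (`= n²`, `= 4n`, `= 2(d−1)n` hold when `n ≤ N`; only the bounds are consumed); surjectivity of the block
points (not needed); the weights `η^d`, i.e. `m₁ = n²·η^d` (print allows `4L^{2k}η^d`), `m₂ = 2(d−1)n·η^d`, `Σ_{r} η^d = 1`, and the junction with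
`…CovariantStokesCounting.sum_sq_le_of_blockAverage_bound` BY NAME (one file once both oleans exist); Lemma CS (i)–(ii) themselves (`…LinearisedLatticeStokes(Rectangle)`), (R-M), (R-V), `c_g ε_F`; which `N, n, d`
are Bałaban's ((A3) ∕ (A1c); NC-NE7b-α UNRULED); anything of Bałaban's.  BY-NAME EFFECT ON THE WALL: NONE.  NE7b NOT PRINTED ∕ NOT PROVED; spine
PROVED 0∕9; rung (B)+1 on a FINITE torus — NOT infinite volume, NOT the mass gap, NOT Clay.
HONEST DEPENDENCY: continuum YM on T⁴ ⇐ BetaPertH ∧ nine spine estimates (0/9 proved); BetaPertH ⇐ (D1) ∧ (D4) ∧ CAP+tail.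
-/

set_option autoImplicit false

namespace Summit.QuantumFields.BalabanUV.T4Continuum.NE7b.BlockSurfaceMultiplicity

open Finset

variable {d N : ℕ} (n : ℕ)

/-! ## §0 The based square and its boundary, characterised as images (inhabited)

The square of side `n` based at `x` in the plane `a = (μ < ν)` is the image of `Fin n × Fin n`, `(i, j) ↦ (x + i e_μ + j e_ν, a)`; its boundary
is the image of `Bool × Bool × Fin n`: (direction flag `c`, near∕far flag `s`, position `i`) ↦ the bond of direction `μ` (`c = true`) or `ν`
(`c = false`) at position `i` on the near side through `x` (`s = true`) or on the far side shifted by `n e_ν` resp. `n e_μ` (`s = false`). -/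

/-- **THE BASED SQUARE EXISTS.** [folklore] -/
theorem exists_square :
    ∃ Sq : (Fin d → ZMod N) → {a : Fin d × Fin d // a.1 < a.2} → Finset ((Fin d → ZMod N) × {a : Fin d × Fin d // a.1 < a.2}),
      ∀ x a, Sq x a = univ.image (fun ij : Fin n × Fin n =>
        (x + Pi.single a.1.1 ((ij.1 : ℕ) : ZMod N) + Pi.single a.1.2 ((ij.2 : ℕ) : ZMod N), a)) :=
  ⟨fun x a => univ.image (fun ij : Fin n × Fin n =>
      (x + Pi.single a.1.1 ((ij.1 : ℕ) : ZMod N) + Pi.single a.1.2 ((ij.2 : ℕ) : ZMod N), a)), fun _ _ => rfl⟩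

/-- **THE BOUNDARY EXISTS.** [folklore] -/
theorem exists_boundary :
    ∃ Bd : (Fin d → ZMod N) → {a : Fin d × Fin d // a.1 < a.2} → Finset ((Fin d → ZMod N) × Fin d),
      ∀ x a, Bd x a = univ.image (fun csi : Bool × Bool × Fin n =>
        if csi.1 then
          (if csi.2.1 then x + Pi.single a.1.1 ((csi.2.2 : ℕ) : ZMod N)
            else x + Pi.single a.1.2 (n : ZMod N) + Pi.single a.1.1 ((csi.2.2 : ℕ) : ZMod N), a.1.1)
        else
          (if csi.2.1 then x + Pi.single a.1.2 ((csi.2.2 : ℕ) : ZMod N)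
            else x + Pi.single a.1.1 (n : ZMod N) + Pi.single a.1.2 ((csi.2.2 : ℕ) : ZMod N), a.1.2)) :=
  ⟨fun x a => univ.image (fun csi : Bool × Bool × Fin n =>
        if csi.1 then
          (if csi.2.1 then x + Pi.single a.1.1 ((csi.2.2 : ℕ) : ZMod N)
            else x + Pi.single a.1.2 (n : ZMod N) + Pi.single a.1.1 ((csi.2.2 : ℕ) : ZMod N), a.1.1)
        else
          (if csi.2.1 then x + Pi.single a.1.2 ((csi.2.2 : ℕ) : ZMod N)
            else x + Pi.single a.1.1 (n : ZMod N) + Pi.single a.1.2 ((csi.2.2 : ℕ) : ZMod N), a.1.2)), fun _ _ => rfl⟩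

section Counts

variable (Sq : (Fin d → ZMod N) → {a : Fin d × Fin d // a.1 < a.2} → Finset ((Fin d → ZMod N) × {a : Fin d × Fin d // a.1 < a.2}))
  (Bd : (Fin d → ZMod N) → {a : Fin d × Fin d // a.1 < a.2} → Finset ((Fin d → ZMod N) × Fin d))

/-! ## §1 Sizes: `#S ≤ n²`, `#∂S ≤ 4n` (print's `Σ_{p∈S_x} η² ≤ 1` with `η² = n⁻²`, `Σ_{b∈∂S_x} η ≤ 4` with `η = n⁻¹`) -/

/-- **THE SQUARE HAS AT MOST `n²` PLAQUETTES.** [folklore] -/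
theorem card_square_le
    (hSq : ∀ x a, Sq x a = univ.image (fun ij : Fin n × Fin n =>
      (x + Pi.single a.1.1 ((ij.1 : ℕ) : ZMod N) + Pi.single a.1.2 ((ij.2 : ℕ) : ZMod N), a)))
    (x : Fin d → ZMod N) (a : {a : Fin d × Fin d // a.1 < a.2}) : (Sq x a).card ≤ n ^ 2 := by
  classical
  rw [hSq]
  refine card_image_le.trans ?_
  rw [card_univ, Fintype.card_prod, Fintype.card_fin, sq]

/-- **THE BOUNDARY HAS AT MOST `4n` BONDS.** [folklore] -/
theorem card_boundary_le
    (hBd : ∀ x a, Bd x a = univ.image (fun csi : Bool × Bool × Fin n =>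
        if csi.1 then
          (if csi.2.1 then x + Pi.single a.1.1 ((csi.2.2 : ℕ) : ZMod N)
            else x + Pi.single a.1.2 (n : ZMod N) + Pi.single a.1.1 ((csi.2.2 : ℕ) : ZMod N), a.1.1)
        else
          (if csi.2.1 then x + Pi.single a.1.2 ((csi.2.2 : ℕ) : ZMod N)
            else x + Pi.single a.1.1 (n : ZMod N) + Pi.single a.1.2 ((csi.2.2 : ℕ) : ZMod N), a.1.2)))
    (x : Fin d → ZMod N) (a : {a : Fin d × Fin d // a.1 < a.2}) : (Bd x a).card ≤ 4 * n := by
  classical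
  rw [hBd]
  refine card_image_le.trans ?_
  rw [card_univ, Fintype.card_prod, Fintype.card_prod, Fintype.card_bool, Fintype.card_fin]
  omega

/-! ## §2 Multiplicities: a fine plaquette lies in `≤ n²` based squares, a fine bond on the boundary of `≤ 2(d−1)·n` based squares -/

/-- **PLAQUETTE MULTIPLICITY `≤ n²`**: a fine plaquette `q = (z, a)` lies in the based square `(x, a')` only if `a' = a` and
`x = z − i e_μ − j e_ν` for some `i, j < n` — print's «at most `L^{2k}` pairs `(P, x)` of its own orientation; `x` determines the block, hence `P`».
Any `N`. [folklore] -/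
theorem square_multiplicity_le [NeZero N]
    (hSq : ∀ x a, Sq x a = univ.image (fun ij : Fin n × Fin n =>
      (x + Pi.single a.1.1 ((ij.1 : ℕ) : ZMod N) + Pi.single a.1.2 ((ij.2 : ℕ) : ZMod N), a)))
    (q : (Fin d → ZMod N) × {a : Fin d × Fin d // a.1 < a.2}) :
    (univ.filter fun xa : (Fin d → ZMod N) × {a : Fin d × Fin d // a.1 < a.2} => q ∈ Sq xa.1 xa.2).card ≤ n ^ 2 := by
  classical
  obtain ⟨z, a⟩ := q
  -- cover: `(i, j) ↦ (z − i e_μ − j e_ν, a)`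
  have hcover : (univ.filter fun xa : (Fin d → ZMod N) × {a : Fin d × Fin d // a.1 < a.2} => (z, a) ∈ Sq xa.1 xa.2)
      ⊆ univ.image (fun ij : Fin n × Fin n =>
        (z - Pi.single a.1.1 ((ij.1 : ℕ) : ZMod N) - Pi.single a.1.2 ((ij.2 : ℕ) : ZMod N), a)) := by
    rintro ⟨x, a'⟩ hxa
    simp only [Finset.mem_filter, Finset.mem_univ, true_and, Finset.mem_image] at hxa ⊢
    rw [hSq] at hxa
    obtain ⟨ij, -, hij⟩ := Finset.mem_image.1 hxa
    simp only [Prod.mk.injEq] at hij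
    obtain ⟨hz, rfl⟩ := hij
    refine ⟨ij, ?_⟩
    rw [Prod.mk.injEq, ← hz]
    exact ⟨by abel, rfl⟩
  calc _ ≤ _ := Finset.card_le_card hcover
    _ ≤ _ := card_image_le
    _ = n ^ 2 := by rw [card_univ, Fintype.card_prod, Fintype.card_fin, sq]

/-- **BOND MULTIPLICITY `≤ 2(d−1)·n`**: a fine bond `b = (z, μ)` lies on the boundary of the based square `(x, (α < β))` only if `μ ∈ {α, β}` and
`b` sits on one of the two sides of direction `μ` — position `i < n` on the near side (`x = z − i e_μ`) or on the far side
(`x = z − n e_ν − i e_μ`, `ν` the plane partner): cover by `{ν // ν ≠ μ} × Bool × Fin n`, of cardinality `(d−1)·2·n` — print's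
«`2L^k` per plane `(μ, ν)`, `ν ≠ μ`, i.e. `≤ 2(d−1)L^k` in all».  Any `N`. [folklore] -/
theorem boundary_multiplicity_le [NeZero N]
    (hBd : ∀ x a, Bd x a = univ.image (fun csi : Bool × Bool × Fin n =>
        if csi.1 then
          (if csi.2.1 then x + Pi.single a.1.1 ((csi.2.2 : ℕ) : ZMod N)
            else x + Pi.single a.1.2 (n : ZMod N) + Pi.single a.1.1 ((csi.2.2 : ℕ) : ZMod N), a.1.1)
        else
          (if csi.2.1 then x + Pi.single a.1.2 ((csi.2.2 : ℕ) : ZMod N)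
            else x + Pi.single a.1.1 (n : ZMod N) + Pi.single a.1.2 ((csi.2.2 : ℕ) : ZMod N), a.1.2)))
    (b : (Fin d → ZMod N) × Fin d) :
    (univ.filter fun xa : (Fin d → ZMod N) × {a : Fin d × Fin d // a.1 < a.2} => b ∈ Bd xa.1 xa.2).card ≤ 2 * (d - 1) * n := by
  classical
  obtain ⟨z, μ⟩ := b
  -- cover: (partner `ν ≠ μ`, near∕far side, position `i`) ↦ (base point, plane {μ, ν})
  let φ : {ν : Fin d // ν ≠ μ} × Bool × Fin n → (Fin d → ZMod N) × {a : Fin d × Fin d // a.1 < a.2} := fun q =>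
    (if q.2.1 then z - Pi.single μ ((q.2.2 : ℕ) : ZMod N)
      else z - Pi.single q.1.1 (n : ZMod N) - Pi.single μ ((q.2.2 : ℕ) : ZMod N),
     ⟨(min μ q.1.1, max μ q.1.1), min_lt_max.2 q.1.2.symm⟩)
  have hcover : (univ.filter fun xa : (Fin d → ZMod N) × {a : Fin d × Fin d // a.1 < a.2} => (z, μ) ∈ Bd xa.1 xa.2)
      ⊆ univ.image φ := by
    rintro ⟨x, ⟨⟨α, β⟩, hαβ⟩⟩ hxa
    simp only [Finset.mem_filter, Finset.mem_univ, true_and, Finset.mem_image] at hxa ⊢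
    rw [hBd] at hxa
    obtain ⟨⟨c, s, i⟩, -, hcsi⟩ := Finset.mem_image.1 hxa
    have hαβ' : α < β := hαβ
    cases c <;> cases s <;> simp only [if_true, Bool.false_eq_true, if_false, Prod.mk.injEq] at hcsi <;>
      obtain ⟨hx, rfl⟩ := hcsi
    · -- direction `β`, far side: `x = z − n e_α − i e_β`, partner `α`
      refine ⟨(⟨α, ne_of_lt hαβ'⟩, false, i), ?_⟩
      simp only [φ, Bool.false_eq_true, if_false, Prod.mk.injEq, min_eq_right hαβ'.le, max_eq_left hαβ'.le, and_true]
      rw [← hx]; abel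
    · -- direction `β`, near side: `x = z − i e_β`, partner `α`
      refine ⟨(⟨α, ne_of_lt hαβ'⟩, true, i), ?_⟩
      simp only [φ, if_true, Prod.mk.injEq, min_eq_right hαβ'.le, max_eq_left hαβ'.le, and_true]
      rw [← hx]; abel
    · -- direction `α`, far side: `x = z − n e_β − i e_α`, partner `β`
      refine ⟨(⟨β, ne_of_gt hαβ'⟩, false, i), ?_⟩
      simp only [φ, Bool.false_eq_true, if_false, Prod.mk.injEq, min_eq_left hαβ'.le, max_eq_right hαβ'.le, and_true]
      rw [← hx]; abel
    · -- direction `α`, near side: `x = z − i e_α`, partner `β`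
      refine ⟨(⟨β, ne_of_gt hαβ'⟩, true, i), ?_⟩
      simp only [φ, if_true, Prod.mk.injEq, min_eq_left hαβ'.le, max_eq_right hαβ'.le, and_true]
      rw [← hx]; abel
  have hdom : Fintype.card ({ν : Fin d // ν ≠ μ} × Bool × Fin n) = 2 * (d - 1) * n := by
    rw [Fintype.card_prod, Fintype.card_prod, Fintype.card_bool, Fintype.card_fin, Fintype.card_subtype, Finset.filter_ne',
      Finset.card_erase_of_mem (Finset.mem_univ μ), Finset.card_univ, Fintype.card_fin]
    ring
  calc _ ≤ (univ.image φ).card := Finset.card_le_card hcover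
    _ ≤ Fintype.card ({ν : Fin d // ν ≠ μ} × Bool × Fin n) := card_image_le.trans (by rw [Finset.card_univ])
    _ = 2 * (d - 1) * n := hdom

/-- **AT `d = 4`: every fine bond lies on the boundary of at most `6n` based squares** (`2·(4−1)·n`). [folklore] -/
theorem boundary_multiplicity_le_four [NeZero N]
    (Bd : (Fin 4 → ZMod N) → {a : Fin 4 × Fin 4 // a.1 < a.2} → Finset ((Fin 4 → ZMod N) × Fin 4))
    (hBd : ∀ x a, Bd x a = univ.image (fun csi : Bool × Bool × Fin n =>
        if csi.1 then
          (if csi.2.1 then x + Pi.single a.1.1 ((csi.2.2 : ℕ) : ZMod N)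
            else x + Pi.single a.1.2 (n : ZMod N) + Pi.single a.1.1 ((csi.2.2 : ℕ) : ZMod N), a.1.1)
        else
          (if csi.2.1 then x + Pi.single a.1.2 ((csi.2.2 : ℕ) : ZMod N)
            else x + Pi.single a.1.1 (n : ZMod N) + Pi.single a.1.2 ((csi.2.2 : ℕ) : ZMod N), a.1.2)))
    (b : (Fin 4 → ZMod N) × Fin 4) :
    (univ.filter fun xa : (Fin 4 → ZMod N) × {a : Fin 4 × Fin 4 // a.1 < a.2} => b ∈ Bd xa.1 xa.2).card ≤ 6 * n := by
  have h := boundary_multiplicity_le n Bd hBd b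
  omega

/-! ## §3 The consumer's two normalisation letters BY VALUE (`u = n⁻²`, `v = n⁻¹`, `t = 4`; `n ≥ 1`) -/

/-- **`#S(P,x)·u ≤ 1` with `u = n⁻²`** — the shape of `…CovariantStokesCounting.sq_usum_le`'s `hS` (print: `Σ_{p∈S_x} η² = 1`). [folklore] -/
theorem card_square_mul_inv_sq_le_one (hn : 0 < n)
    (hSq : ∀ x a, Sq x a = univ.image (fun ij : Fin n × Fin n =>
      (x + Pi.single a.1.1 ((ij.1 : ℕ) : ZMod N) + Pi.single a.1.2 ((ij.2 : ℕ) : ZMod N), a)))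
    (x : Fin d → ZMod N) (a : {a : Fin d × Fin d // a.1 < a.2}) : ((Sq x a).card : ℝ) * (1 / (n : ℝ) ^ 2) ≤ 1 := by
  have h : ((Sq x a).card : ℝ) ≤ (n : ℝ) ^ 2 := by exact_mod_cast card_square_le n Sq hSq x a
  have hn0 : (0 : ℝ) < (n : ℝ) := by exact_mod_cast hn
  have hn' : (0 : ℝ) < (n : ℝ) ^ 2 := pow_pos hn0 2
  rw [mul_one_div, div_le_one hn']
  exact h

/-- **`#T(P,x)·v ≤ t` with `v = n⁻¹`, `t = 4`** — the shape of `…CovariantStokesCounting.sq_vsum_le`'s `hT` (print: `Σ_{b∈∂S_x} η = 4`). [folklore] -/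
theorem card_boundary_mul_inv_le_four (hn : 0 < n)
    (hBd : ∀ x a, Bd x a = univ.image (fun csi : Bool × Bool × Fin n =>
        if csi.1 then
          (if csi.2.1 then x + Pi.single a.1.1 ((csi.2.2 : ℕ) : ZMod N)
            else x + Pi.single a.1.2 (n : ZMod N) + Pi.single a.1.1 ((csi.2.2 : ℕ) : ZMod N), a.1.1)
        else
          (if csi.2.1 then x + Pi.single a.1.2 ((csi.2.2 : ℕ) : ZMod N)
            else x + Pi.single a.1.1 (n : ZMod N) + Pi.single a.1.2 ((csi.2.2 : ℕ) : ZMod N), a.1.2)))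
    (x : Fin d → ZMod N) (a : {a : Fin d × Fin d // a.1 < a.2}) : ((Bd x a).card : ℝ) * (1 / (n : ℝ)) ≤ 4 := by
  have h : ((Bd x a).card : ℝ) ≤ 4 * (n : ℝ) := by exact_mod_cast card_boundary_le n Bd hBd x a
  have hn' : (0 : ℝ) < (n : ℝ) := by exact_mod_cast hn
  rw [mul_one_div, div_le_iff₀ hn']
  exact h

end Counts

/-! ## §4 The two-scale torus: block points `(y, r) ↦ n·y + r` are distinct, so the multiplicities in print's `(P, x ∈ B^k(y_P))` indexing are the same

Fine modulus `n·M` (print: `M = |Λ_k|^{1∕d}` unit sites per direction, `n = L^k` fine points per unit length); a coarse site `y : Fin d → ZMod M`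
and an offset `r : Fin d → Fin n` name the fine point `x_i = n·y_i + r_i` (hypothesis-free lambda below).  Injectivity of `(y, r) ↦ x` is all the
consumer's exchange of summation needs: a count over pairs `((y, a), r)` is at most the count over pairs `(x, a)`. -/

section Blocks

variable {M : ℕ}

/-- **BLOCK POINTS ARE DISTINCT**: `(y, r) ↦ (i ↦ n·val(y_i) + r_i : ZMod (n·M))` is injective on `(Fin d → ZMod M) × (Fin d → Fin n)`
(`n·val(y_i) + r_i < n·M`, then Euclidean division by `n`). [folklore] -/
theorem blockPoint_injective [NeZero M] (hn : 0 < n) :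
    Function.Injective (fun yr : (Fin d → ZMod M) × (Fin d → Fin n) =>
      fun i => (((yr.1 i).val * n + (yr.2 i : ℕ) : ℕ) : ZMod (n * M))) := by
  haveI : NeZero (n * M) := ⟨Nat.mul_ne_zero hn.ne' (NeZero.ne M)⟩
  rintro ⟨y, r⟩ ⟨y', r'⟩ h
  have hlt : ∀ (w : ZMod M) (s : Fin n), w.val * n + (s : ℕ) < n * M := fun w s => by
    have hw : w.val + 1 ≤ M := ZMod.val_lt w
    calc w.val * n + (s : ℕ) < w.val * n + n := by have := s.isLt; omega
      _ = (w.val + 1) * n := by ring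
      _ ≤ M * n := Nat.mul_le_mul_right n hw
      _ = n * M := Nat.mul_comm M n
  have hi : ∀ i, (y i).val * n + (r i : ℕ) = (y' i).val * n + (r' i : ℕ) := fun i => by
    have h1 := congrFun h i
    simp only at h1
    have h2 := congrArg ZMod.val h1
    rwa [ZMod.val_natCast, ZMod.val_natCast, Nat.mod_eq_of_lt (hlt (y i) (r i)), Nat.mod_eq_of_lt (hlt (y' i) (r' i))] at h2
  have hdiv : ∀ (w : ZMod M) (s : Fin n), (w.val * n + (s : ℕ)) / n = w.val := fun w s => by
    rw [Nat.add_comm, Nat.add_mul_div_right _ _ hn, Nat.div_eq_of_lt s.isLt, Nat.zero_add]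
  have hmod : ∀ (w : ZMod M) (s : Fin n), (w.val * n + (s : ℕ)) % n = (s : ℕ) := fun w s => by
    rw [Nat.add_comm, Nat.add_mul_mod_self_right, Nat.mod_eq_of_lt s.isLt]
  refine Prod.ext (funext fun i => ZMod.val_injective M ?_) (funext fun i => Fin.ext ?_)
  · rw [← hdiv (y i) (r i), hi i, hdiv]
  · rw [← hmod (y i) (r i), hi i, hmod]

/-- **PLAQUETTE MULTIPLICITY IN BLOCK INDEXING**: over pairs `((y, a), r)` — coarse plaquette `(y, a)`, offset `r` in the block — a fine plaquette
lies in at most `n²` based squares `Sq (n·y + r) a` (print's «at most `L^{2k}` pairs `(P, x)`»; the weight `η^d` multiplies on). [folklore] -/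
theorem block_square_multiplicity_le [NeZero M] (hn : 0 < n)
    (Sq : (Fin d → ZMod (n * M)) → {a : Fin d × Fin d // a.1 < a.2} →
      Finset ((Fin d → ZMod (n * M)) × {a : Fin d × Fin d // a.1 < a.2}))
    (hSq : ∀ x a, Sq x a = univ.image (fun ij : Fin n × Fin n =>
      (x + Pi.single a.1.1 ((ij.1 : ℕ) : ZMod (n * M)) + Pi.single a.1.2 ((ij.2 : ℕ) : ZMod (n * M)), a)))
    (q : (Fin d → ZMod (n * M)) × {a : Fin d × Fin d // a.1 < a.2}) :
    (univ.filter fun p : ((Fin d → ZMod M) × {a : Fin d × Fin d // a.1 < a.2}) × (Fin d → Fin n) =>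
      q ∈ Sq (fun i => (((p.1.1 i).val * n + (p.2 i : ℕ) : ℕ) : ZMod (n * M))) p.1.2).card ≤ n ^ 2 := by
  classical
  haveI : NeZero (n * M) := ⟨Nat.mul_ne_zero hn.ne' (NeZero.ne M)⟩
  refine le_trans ?_ (square_multiplicity_le n Sq hSq q)
  refine Finset.card_le_card_of_injOn
    (fun p => ((fun i => (((p.1.1 i).val * n + (p.2 i : ℕ) : ℕ) : ZMod (n * M))), p.1.2)) (fun p hp => ?_) (fun p₁ _ p₂ _ h => ?_)
  · simp only [Finset.coe_filter, Finset.mem_univ, true_and, Set.mem_setOf_eq] at hp ⊢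
    exact hp
  · simp only [Prod.mk.injEq] at h
    obtain ⟨h1, h2⟩ := h
    have h3 := blockPoint_injective n hn (a₁ := (p₁.1.1, p₁.2)) (a₂ := (p₂.1.1, p₂.2)) h1
    simp only [Prod.mk.injEq] at h3
    exact Prod.ext (Prod.ext h3.1 h2) h3.2

/-- **BOND MULTIPLICITY IN BLOCK INDEXING**: over pairs `((y, a), r)` a fine bond lies on the boundary of at most `2(d−1)·n` based squares
`Bd (n·y + r) a` (print's «`≤ 2(d−1)L^k` pairs `(P, x)`»; the weight `η^d` multiplies on). [folklore] -/
theorem block_boundary_multiplicity_le [NeZero M] (hn : 0 < n)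
    (Bd : (Fin d → ZMod (n * M)) → {a : Fin d × Fin d // a.1 < a.2} → Finset ((Fin d → ZMod (n * M)) × Fin d))
    (hBd : ∀ x a, Bd x a = univ.image (fun csi : Bool × Bool × Fin n =>
        if csi.1 then
          (if csi.2.1 then x + Pi.single a.1.1 ((csi.2.2 : ℕ) : ZMod (n * M))
            else x + Pi.single a.1.2 (n : ZMod (n * M)) + Pi.single a.1.1 ((csi.2.2 : ℕ) : ZMod (n * M)), a.1.1)
        else
          (if csi.2.1 then x + Pi.single a.1.2 ((csi.2.2 : ℕ) : ZMod (n * M))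
            else x + Pi.single a.1.1 (n : ZMod (n * M)) + Pi.single a.1.2 ((csi.2.2 : ℕ) : ZMod (n * M)), a.1.2)))
    (b : (Fin d → ZMod (n * M)) × Fin d) :
    (univ.filter fun p : ((Fin d → ZMod M) × {a : Fin d × Fin d // a.1 < a.2}) × (Fin d → Fin n) =>
      b ∈ Bd (fun i => (((p.1.1 i).val * n + (p.2 i : ℕ) : ℕ) : ZMod (n * M))) p.1.2).card ≤ 2 * (d - 1) * n := by
  classical
  haveI : NeZero (n * M) := ⟨Nat.mul_ne_zero hn.ne' (NeZero.ne M)⟩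
  refine le_trans ?_ (boundary_multiplicity_le n Bd hBd b)
  refine Finset.card_le_card_of_injOn
    (fun p => ((fun i => (((p.1.1 i).val * n + (p.2 i : ℕ) : ℕ) : ZMod (n * M))), p.1.2)) (fun p hp => ?_) (fun p₁ _ p₂ _ h => ?_)
  · simp only [Finset.coe_filter, Finset.mem_univ, true_and, Set.mem_setOf_eq] at hp ⊢
    exact hp
  · simp only [Prod.mk.injEq] at h
    obtain ⟨h1, h2⟩ := h
    have h3 := blockPoint_injective n hn (a₁ := (p₁.1.1, p₁.2)) (a₂ := (p₂.1.1, p₂.2)) h1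
    simp only [Prod.mk.injEq] at h3
    exact Prod.ext (Prod.ext h3.1 h2) h3.2

end Blocks

end Summit.QuantumFields.BalabanUV.T4Continuum.NE7b.BlockSurfaceMultiplicity
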